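import Summits.Ventures.QEC.CircuitDistance.ETowerFiber
import HarnessLib

/-!
# P3-PORT STEP 2 (E-fold tower): WINDOWED fibre completeness (`scanW` / `fiberKW` / `nodeKW`; CARD-7 §5 S1w, PORT-SPEC S1w)
# (cell `qec`, experiment CDX, seat qec-cdx-type-1)

`scanW … lo hi i` keeps, of the include/skip subset scan `scan`, exactly the branches whose FIRST chosen outside column has
list position `p` (counted from `i`) with `lo ≤ i + p < hi`; the empty subset is kept iff `lo = 0`.  Hence for a family of
windows containing one with `lo = 0` and covering every position of the outside list, the union of the `fiberKW` outputs
contains everything `fiberK` would output: `fiberKW_complete` (same hypotheses and conclusion as `fiberK_complete`, over the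
union), and `nodeKW_sound` at node level (every fibre word has a listing passing the continuation).  Generic; no data.
-/

namespace Summit.Ventures.QEC.CircuitDistance.ETower

open Summit.Ventures.QEC.Census Summit.Ventures.QEC.Census.Fold

/-! ## `scanW` versus `scan` -/

/-- The empty subset (a leaf at the root residual) is recorded by every window with `lo = 0`. -/
theorem scanW_nil_complete (Pv : Piv) (MP : List ℕ) :
    ∀ (O : List (ℕ × ℕ × ℕ)) (s v rv hi i : ℕ) (x : ℕ), rv = 0 → x ∈ Pv.solutions MP v →
      ([], x) ∈ scanW Pv MP O s v rv 0 hi i := by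
  intro O
  induction O with
  | nil =>
    intro s v rv hi i x hrv hx
    subst hrv
    unfold scanW
    simp only [beq_self_eq_true, ↓reduceIte, List.mem_map]
    exact ⟨x, hx, rfl⟩
  | cons oc O ih =>
    intro s v rv hi i x hrv hx
    cases s with
    | zero =>
      subst hrv
      unfold scanW
      simp only [beq_self_eq_true, ↓reduceIte, List.mem_map]
      exact ⟨x, hx, rfl⟩
    | succ s' =>
      unfold scanW
      exact List.mem_append_right _ (ih (s' + 1) v rv hi (i + 1) x hrv hx)

/-- **WINDOWED SCAN COMPLETENESS**: a non-empty sub-list `e'` of the outside triples within budget, with residual reducing to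
`0` and a listed solution `x`, is recorded by every window `[lo, hi)` containing the position (from `i`) of its first triple. -/
theorem scanW_complete (Pv : Piv) (MP : List ℕ) :
    ∀ (O : List (ℕ × ℕ × ℕ)) (s v rv i : ℕ) (e' : List (ℕ × ℕ × ℕ)), e'.Sublist O → e' ≠ [] →
      e'.length ≤ s → rv ^^^ xorIdx (fun oc => oc.2.2) e' = 0 →
      ∀ x ∈ Pv.solutions MP (v ^^^ xorIdx (fun oc => oc.2.1) e'),
        ∃ p, p < O.length ∧ ∀ lo hi, lo ≤ i + p → i + p < hi →
          ((e'.map Prod.fst).reverse, x) ∈ scanW Pv MP O s v rv lo hi i := by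
  intro O
  induction O with
  | nil =>
    intro s v rv i e' he' hne _ _ x _
    rw [List.sublist_nil] at he'
    exact absurd he' hne
  | cons oc O ih =>
    intro s v rv i e' he' hne hlen hrv x hx
    cases s with
    | zero => exact absurd (List.eq_nil_of_length_eq_zero (Nat.le_zero.1 hlen)) hne
    | succ s' =>
      cases he' with
      | cons _ he'' =>
        obtain ⟨p, hp, hmem⟩ := ih (s' + 1) v rv (i + 1) e' he'' hne hlen hrv x hx
        refine ⟨p + 1, by simp only [List.length_cons]; omega, fun lo hi hlo hhi => ?_⟩
        unfold scanW
        exact List.mem_append_right _ (hmem lo hi (by omega) (by omega))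
      | cons_cons _ he'' =>
        rename_i e''
        refine ⟨0, by simp, fun lo hi hlo hhi => ?_⟩
        have hx' : x ∈ Pv.solutions MP ((v ^^^ oc.2.1) ^^^ xorIdx (fun oc => oc.2.1) e'') := by
          rw [xorIdx_cons, ← Nat.xor_assoc] at hx; exact hx
        have hrv' : (rv ^^^ oc.2.2) ^^^ xorIdx (fun oc => oc.2.2) e'' = 0 := by
          rw [xorIdx_cons, ← Nat.xor_assoc] at hrv; exact hrv
        have := scan_complete Pv MP O s' (v ^^^ oc.2.1) (rv ^^^ oc.2.2) [oc.1] e'' he''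
          (by simp at hlen; omega) hrv' x hx'
        unfold scanW
        refine List.mem_append_left _ ?_
        have hcond : (decide (lo ≤ i) && decide (i < hi)) = true := by
          rw [Bool.and_eq_true, decide_eq_true_eq, decide_eq_true_eq]; omega
        rw [if_pos hcond]
        simpa [List.reverse_cons] using this

/-! ## What success of `fiberKW` certifies -/

/-- If `fiberKW` succeeds, the full pivot structure verified. -/
theorem pivOK_of_fiberKW (G : Geo) (ns : ℕ) (M Mp : ℕ → ℕ) (W : ℕ) (P : List ℕ) (lo hi : ℕ) {out : List (List ℕ)}
    (hout : fiberKW G ns M Mp W P lo hi = some out) : pivOK (P.map M) (gaussPiv (P.map M)) = true := by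
  unfold fiberKW at hout
  simp only at hout
  split at hout
  · assumption
  · simp at hout

/-- The output list of a successful `fiberKW`. -/
theorem fiberKW_eq (G : Geo) (ns : ℕ) (M Mp : ℕ → ℕ) (W : ℕ) (P : List ℕ) (lo hi : ℕ) {out : List (List ℕ)}
    (hout : fiberKW G ns M Mp W P lo hi = some out) :
    out = (scanW (gaussPiv (P.map M)) (P.map M)
      ((outsideOf ns P).map fun o => (o, M o, (gaussPiv (P.map M)).red (M o))) ((W - P.length) / 2) (frhs Mp P)
      ((gaussPiv (P.map M)).red (frhs Mp P)) lo hi 0).map fun ex => mkWord G P ex.1 ex.2 := by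
  unfold fiberKW at hout
  simp only at hout
  split at hout
  · simp only [Option.some.injEq] at hout; exact hout.symm
  · simp at hout

/-- **Combinatorial completeness of the windows**: a within-budget sub-list `e'` of the outside positions whose residual
reduces to `0`, with a listed solution, yields a word recorded (i) by every window with `lo = 0` if `e' = []`, (ii) by every
window containing the position of its first element otherwise. -/
theorem mem_fiberKW_of_solution (G : Geo) (ns : ℕ) (M Mp : ℕ → ℕ) (W : ℕ) (P : List ℕ) (e' : List ℕ)
    (he' : e'.Sublist (outsideOf ns P)) (hlen : e'.length ≤ (W - P.length) / 2)
    (hred : (gaussPiv (P.map M)).red (frhs Mp P ^^^ xorIdx M e') = 0) (x : ℕ)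
    (hx : x ∈ (gaussPiv (P.map M)).solutions (P.map M) (frhs Mp P ^^^ xorIdx M e')) :
    (e' = [] → ∀ hi out, fiberKW G ns M Mp W P 0 hi = some out → mkWord G P [] x ∈ out) ∧
    (e' ≠ [] → ∃ p, p < (outsideOf ns P).length ∧ ∀ lo hi out, lo ≤ p → p < hi →
      fiberKW G ns M Mp W P lo hi = some out → mkWord G P e'.reverse x ∈ out) := by
  set Pv := gaussPiv (P.map M) with hPv
  constructor
  · intro he0 hi out hout
    subst he0
    rw [fiberKW_eq G ns M Mp W P 0 hi hout, List.mem_map]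
    refine ⟨([], x), ?_, by simp⟩
    simp only [xorIdx_nil, Nat.xor_zero] at hx hred
    exact scanW_nil_complete Pv (P.map M) _ _ _ _ hi 0 x hred hx
  · intro hne
    have hsub : (e'.map fun o => (o, M o, Pv.red (M o))).Sublist
        ((outsideOf ns P).map fun o => (o, M o, Pv.red (M o))) := he'.map _
    have hx2 : x ∈ Pv.solutions (P.map M)
        (frhs Mp P ^^^ xorIdx (fun oc : ℕ × ℕ × ℕ => oc.2.1) (e'.map fun o => (o, M o, Pv.red (M o)))) := by
      rw [xorIdx_map]; exact hx
    have hrv : Pv.red (frhs Mp P) ^^^ xorIdx (fun oc : ℕ × ℕ × ℕ => oc.2.2)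
        (e'.map fun o => (o, M o, Pv.red (M o))) = 0 := by
      rw [xorIdx_map, ← hred, red_xor, red_xorIdx]; rfl
    have hne' : (e'.map fun o => (o, M o, Pv.red (M o))) ≠ [] := by simpa using hne
    obtain ⟨p, hp, hmem⟩ := scanW_complete Pv (P.map M) _ ((W - P.length) / 2) (frhs Mp P) _ 0 _ hsub hne'
      (by rw [List.length_map]; exact hlen) hrv x hx2
    rw [List.length_map] at hp
    refine ⟨p, hp, fun lo hi out hlo hhi hout => ?_⟩
    rw [fiberKW_eq G ns M Mp W P lo hi hout, List.mem_map]
    refine ⟨(e'.reverse, x), ?_, rfl⟩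
    have := hmem lo hi (by simpa using hlo) (by simpa using hhi)
    rw [List.map_map] at this
    have hid : List.map (Prod.fst ∘ fun o => (o, M o, Pv.red (M o))) e' = e' := by
      rw [show (Prod.fst ∘ fun o => (o, M o, Pv.red (M o))) = id from rfl, List.map_id]
    rw [hid] at this
    exact this

/-! ## Windowed fibre completeness -/

section Complete

variable {G : Geo} {nb : ℕ}

/-- **WINDOWED FIBRE COMPLETENESS.**  As `fiberK_complete`, for a family of windows `WINS` containing a window with `lo = 0`
and covering every position of the outside list, each window having succeeded with outputs satisfying `Q`: every big word of
weight `≤ W` with zero `col`-syndrome and fold `t` has a listing satisfying `Q`. -/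
theorem fiberKW_complete (hG : OKK G nb) {col : ℕ → ℕ} {M Mp : ℕ → ℕ}
    (hM : ∀ j, j < nsK G nb → M j = col (G.emb j) ^^^ col (G.partner (G.emb j)))
    (hMp : ∀ j, j < nsK G nb → Mp j = col (G.partner (G.emb j))) {W t : ℕ} (ht : t < 2 ^ nsK G nb)
    (WINS : List (ℕ × ℕ)) (Q : List ℕ → Prop) (hzero : ∃ w ∈ WINS, w.1 = 0)
    (hcover : ∀ p, p < (outsideOf (nsK G nb) (bitsOf (nsK G nb) 0 t)).length → ∃ w ∈ WINS, w.1 ≤ p ∧ p < w.2)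
    (hall : ∀ w ∈ WINS, ∃ out, fiberKW G (nsK G nb) M Mp W (bitsOf (nsK G nb) 0 t) w.1 w.2 = some out ∧ ∀ S ∈ out, Q S)
    {u : ℕ} (hu : u < 2 ^ nK G nb) (hker : kerK col (nK G nb) u) (hwt : popc (nK G nb) u ≤ W)
    (hfold : foldWK G nb u = t) :
    ∃ S, Q S ∧ maskOf S = u ∧ (∀ J ∈ S, J < nK G nb) ∧ S.length = popc (nK G nb) u := by
  -- names (as in `fiberK_complete`)
  set fc : ℕ → ℕ := fun j => col (G.emb j) ^^^ col (G.partner (G.emb j)) with hfcdef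
  set P := bitsOf (nsK G nb) 0 t with hPdef
  set a := aPartK G nb u with ha
  set b := bPartK G nb u with hb
  have hab : a ^^^ b = t := by rw [ha, hb, ← foldWK_eq_parts, hfold]
  have hbt : b = a ^^^ t := by rw [← hab, ← Nat.xor_assoc, Nat.xor_self, Nat.zero_xor]
  have hPlt : ∀ j ∈ P, j < nsK G nb := fun j hj => lt_of_mem_bitsOf hj
  have hPmask : maskOf P = t := maskOf_bitsOf_zero _ _ ht
  have hPlen : P.length = popc (nsK G nb) t := length_bitsOf _ _ _
  have hPM : P.map M = P.map fc := List.map_congr_left fun j hj => hM j (hPlt j hj)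
  set O := outsideOf (nsK G nb) P with hOdef
  set e := O.filter fun j => (a &&& b).testBit j with hedef
  set x := restrictTo P 0 a with hxdef
  have hPnodup : P.Nodup := hPdef ▸ nodup_bitsOf _ _ _
  have hOmem : ∀ j, j ∈ O ↔ j < nsK G nb ∧ j ∉ P := fun j => by
    rw [hOdef, outsideOf, mem_bitsOf_zero_iff, Nat.testBit_xor, Nat.testBit_two_pow_sub_one,
      testBit_maskOf_nodup P hPnodup]
    by_cases hj : j < nsK G nb <;> by_cases hp : j ∈ P <;> simp [hj, hp]
  have hOlt : ∀ j ∈ O, j < nsK G nb := fun j hj => ((hOmem j).1 hj).1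
  have helt : ∀ j ∈ e, j < nsK G nb := fun j hj => hOlt j (List.mem_of_mem_filter hj)
  have heM : xorIdx M e = xorIdx fc e := xorIdx_congr fun j hj => hM j (helt j hj)
  have hfr : frhs Mp P = lin (fun j => col (G.partner (G.emb j))) (nsK G nb) 0 t := by
    rw [frhs, xorIdx_congr (h := fun j => col (G.partner (G.emb j))) (fun j hj => hMp j (hPlt j hj)),
      xorIdx_eq_lin _ _ _ hPlt, hPmask]
  have hOnodup : O.Nodup := hOdef ▸ nodup_bitsOf _ _ _
  have hecard : e.length = popc (nsK G nb) (a &&& b) := by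
    rw [popc_eq_card, hedef, ← List.toFinset_card_of_nodup (hOnodup.filter _), List.toFinset_filter]
    congr 1
    ext i
    simp only [Finset.mem_filter, Finset.mem_range, List.mem_toFinset, hOmem]
    constructor
    · rintro ⟨⟨hi, -⟩, hb'⟩; exact ⟨hi, hb'⟩
    · rintro ⟨hi, hb'⟩
      refine ⟨⟨hi, ?_⟩, hb'⟩
      rw [hPdef, mem_bitsOf_zero_iff, ← hab, Nat.testBit_xor]
      rw [Nat.testBit_and, Bool.and_eq_true] at hb'
      rw [hb'.1, hb'.2]; simp
  have hemask : maskOf e = a &&& b := by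
    rw [hedef, maskOf_filter_testBit]
    apply Nat.eq_of_testBit_eq; intro i
    rw [Nat.testBit_and, testBit_maskOf_nodup O hOnodup]
    rcases hbit : (a &&& b).testBit i with _ | _
    · simp
    · simp only [Bool.true_and, decide_eq_true_eq, hOmem]
      rw [Nat.testBit_and, Bool.and_eq_true] at hbit
      refine ⟨?_, ?_⟩
      · by_contra hi
        rw [not_lt] at hi
        have := Nat.testBit_lt_two_pow (lt_of_lt_of_le (aPartK_lt hG u) (Nat.pow_le_pow_right (by norm_num) hi))
        rw [← ha] at this; rw [this] at hbit; exact Bool.false_ne_true hbit.1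
      · have hti : t.testBit i = false := by
          rw [← hab, Nat.testBit_xor, hbit.1, hbit.2]; rfl
        rw [hPdef, mem_bitsOf_zero_iff, hti]; simp
  have hw : popc (nK G nb) u = popc (nsK G nb) t + 2 * popc (nsK G nb) (a &&& b) := by
    rw [popc_eq_partsK hG hu, ← ha, ← hb, ← popc_xor_add, hab]
  have hlen : e.length ≤ (W - P.length) / 2 := by rw [hecard, hPlen]; omega
  -- the linear system
  have hsys : selXor (P.map M) x = frhs Mp P ^^^ xorIdx M e := by
    have h0 : lin col (nK G nb) 0 u = 0 := hker
    rw [reconK hG hu, lin_xor, lin_col_embWK hG, lin_col_parWK hG, ← ha, ← hb, hbt, lin_xor] at h0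
    have hf : lin (fun j => col (G.emb j)) (nsK G nb) 0 a ^^^ lin (fun j => col (G.partner (G.emb j))) (nsK G nb) 0 a =
        lin fc (nsK G nb) 0 a := by rw [← lin_xor_fun]
    have ha2 : lin fc (nsK G nb) 0 a = xorIdx M e ^^^ selXor (P.map M) x := by
      conv_lhs => rw [← and_xor_self_decomp a b, hab, lin_xor]
      rw [heM, hPM, xorIdx_eq_lin _ _ _ helt, hemask, selXor_map_eq_lin _ _ _ hPlt, hxdef, selP_restrictTo, hPmask]
    rw [← Nat.xor_assoc, hf, ← hfr, ha2] at h0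
    exact xor_eq_of_xor_xor_eq_zero h0
  -- a window with lo = 0 exists, hence the pivot structure verified
  obtain ⟨w0, hw0, hw0lo⟩ := hzero
  obtain ⟨out0, hout0, hQ0⟩ := hall w0 hw0
  have hpiv : pivOK (P.map M) (gaussPiv (P.map M)) = true := pivOK_of_fiberKW G (nsK G nb) M Mp W P w0.1 w0.2 hout0
  have hxlt : x < 2 ^ (P.map M).length := by
    rw [List.length_map, hxdef]; have := restrictTo_lt P 0 a; rwa [Nat.zero_add] at this
  have hxsol : x ∈ (gaussPiv (P.map M)).solutions (P.map M) (frhs Mp P ^^^ xorIdx M e) := by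
    have := solutions_complete (pivOKcore_of_pivOK hpiv) x
    rwa [Nat.mod_eq_of_lt hxlt, hsys] at this
  have hred : (gaussPiv (P.map M)).red (frhs Mp P ^^^ xorIdx M e) = 0 := by
    rw [← hsys]; exact red_selXor hpiv x
  have herev : ∀ j ∈ e.reverse, j < nsK G nb := fun j hj => helt j (List.mem_reverse.1 hj)
  have hboth := mem_fiberKW_of_solution G (nsK G nb) M Mp W P e (List.filter_sublist) hlen hred x hxsol
  -- the word and its properties
  have hmask : maskOf (mkWord G P e.reverse x) = u := by
    have h1 : (a &&& b) ^^^ (a &&& t) = a := by rw [← hab]; exact and_xor_self_decomp a b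
    have h2 : (a &&& b) ^^^ (t ^^^ (a &&& t)) = b := by
      rw [Nat.xor_left_comm, h1, hbt, Nat.xor_comm]
    rw [maskOf_mkWordK P e.reverse hPlt herev, maskOf_reverse, hemask, hxdef, selP_restrictTo, hPmask, h1, h2]
    exact (reconK hG hu).symm
  have hlength : (mkWord G P e.reverse x).length = popc (nK G nb) u := by
    rw [Geo.length_mkWord, List.length_reverse, hw, hecard, hPlen]; ring
  -- which window records it
  by_cases he0 : e = []
  · refine ⟨mkWord G P e.reverse x, ?_, hmask, mkWord_boundK hG P e.reverse hPlt herev x, hlength⟩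
    have hmem := hboth.1 he0 w0.2 out0 (by rw [← hw0lo]; exact hout0)
    rw [he0, List.reverse_nil]
    exact hQ0 _ hmem
  · obtain ⟨p, hp, hmem⟩ := hboth.2 he0
    obtain ⟨w, hw', hlo, hhi⟩ := hcover p hp
    obtain ⟨out, hout, hQ⟩ := hall w hw'
    exact ⟨mkWord G P e.reverse x, hQ _ (hmem w.1 w.2 out hlo hhi hout), hmask,
      mkWord_boundK hG P e.reverse hPlt herev x, hlength⟩

end Complete

end Summit.Ventures.QEC.CircuitDistance.ETower
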